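import Literature.AlgebraicGeometry.AbelianSchemes.TupleIsoGenericInjectivityFromOneField   -- ★ (GS-3c′) `forall_eq_of_tupleIsoAt_generic_of_algClosed` (+ ★ (GS-3) by import)
import Literature.AlgebraicGeometry.AbelianSchemes.PolarizedTupleStagePieces                 -- ★ (b0″) ED. 2 `exists_opens_isomPieces`
import Literature.AlgebraicGeometry.AbelianSchemes.PolarizedTupleSheetSeparationTransport      -- ★ (Z4-transport) `forall_eq_of_tupleIso_comp_comp_of_reads_of_separates`
import Literature.AlgebraicGeometry.Motives.IntegralModelStageSheetRefinement                -- ★ (Z1)(Z2)(Z5)(Z6) stage bookkeeping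
import Literature.AlgebraicGeometry.Motives.IntegralModelStageSheetSpecialPoints             -- ★ A-p14 (g36) (G4) `specialPoint_stageSheet_eq`, centre, recovery
import HarnessLib

/-!
# SPECIAL FINE-MODULI INJECTIVITY OFF A FINITE SET OF PRIMES FOR A STAGE TUPLE LOCALISED AT `w`, FROM ONE-SHEET GENERIC SEPARATION (the `stub_INJ0` CORE ZIP)

Topic `AlgebraicGeometry/AbelianSchemes`; namespace `Literature.AlgebraicGeometry.AbelianSchemes.AbelianSchemeOver`.  THEOREMS ONLY (no definition, no
instance, no notation, no named fact, no `sorry`).  Cell `hodgecm-mathlib` (D-0151), P6 «MOD programme» (crux hLiu418 = stmt-HodgeConjecture-24832, `--supports`,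
count-neutral); P-LINE ED. 2 closer leaf `Cruxes/HLiu418/Lines/F0_P6a_PELSpread.lean`, socket `stub_INJ0 : RecordInj0OfStageCofinal` (desk leaf cand v4∕v4b, A-p14
(g35) STAGE CUT, LEAD «M-55b» (2)).  HC_CM is proved only modulo the printed citations until rung 0 closes; nothing here is about HC.

THE MATHEMATICS ([MumfordFogartyKirwan1994] Ch. 7 §2 Prop. 7.3, §3 Thm. 7.9; [EGAIV3] Thm. 8.8.2, (8.10.5), (9.2.1)–(9.2.3); [SerreTate1968] §1).  Let `𝒳` be a
global integral model over `𝓞 F` of the Galois thickening `X ⊗_F Fᵢ` (regarded over `F`), quasi-compact, quasi-separated, locally of finite presentation and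
separated, and `(𝒜, ι, Â, 𝒫, λ, lvl)` ONE PEL tuple over a stage `𝒳 ⊗ D(t)`, `D(t) = Spec 𝓞_F[1∕t]`.  Then there is a FINITE set `S_inj` of primes of `F` such
that for every `w ∉ S_inj`, every localisation leg `τ : Spec 𝒪_{F,(w)} → D(t)`, every `F`-embedding `e : Fᵢ → Ω̄_w` and every tuple `B` over `X ⊗_F Fᵢ` which
(sepB) SEPARATES the `Ω̄_w`-points of `X` on the sheet `e` and (readB) READS the localised stage tuple `τ^*𝒜` at the generic points `ℓ_e y` of that sheet, two
points `y₁, y₂ ∈ X(Ω̄_w)` whose reductions `x̄ᵢ = red(ℓ_e yᵢ) ∈ 𝒳_w(κ̄(w))` carry isomorphic `τ^*𝒜`-tuples have `x̄₁ = x̄₂` — the law `PELInj0LawAt T` of the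
P-line for `T.univ = 𝒜ₜ ×_{stage} 𝓨_(w)` (`IsStageLocalisationAt`), `sepB = ESepAt … T.E` on the sheet `e`, `readB = T.gen_iso e`.
PROOF (the census `CENSUS-stubINJ0-globalfamily.v2` §1 of A-p14 (g35), all organs ★): (Z1) refine the stage to `t″ → t, t′` where `t′` carries the ★ (GS-3a)
`𝓞 Fᵢ`-structure `h′`, move `h′` to `t″` (its generic value is kept) and the tuple to `t″` (★ (R1) rebase; no equality of iterated base changes is used);
(Z2) `q := h″ ≫ pr₁ : 𝒳 ⊗ D(t″) → Spec 𝓞 Fᵢ` is quasi-compact, locally of finite type and separated (cancellation against `Spec 𝓞Fᵢ → Spec 𝓞F`), the stage is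
Noetherian, so ★ (b0″) `exists_opens_isomPieces` gives the `Isom`-pieces of the tuple on an open `𝒱 ⊇` generic fibre with `q(𝒳 ⊗ D(t″) ∖ 𝒱)` finite;
(Z3) `S_inj := V(t″) ∪ under(q(∁𝒱)) ∪ under(S)` where `S` is the finite set of ★ (GS-3) `exists_finset_forall_eq_of_tupleIsoAt` IF its generic-injectivity
hypothesis `hgen` holds (else `∅` — that branch is refuted at the first `w` by (Z4)); (Z4) at `w ∉ S_inj`: `hgen` (every algebraically closed `Ω`) follows
from (sepB)+(readB) at the ONE field `Ω̄_w` by ★ (GS-3c′) `forall_eq_of_tupleIsoAt_generic_of_algClosed` along `ι₀ = e|𝓞Fᵢ` — a point of `𝒱` over `Spec ι₀`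
factors through the generic fibre (`𝒳.genericIso`) on the sheet `e` (★ `thickeningLift_embOfPoint_map_thickeningπ`, `IsFractionRing` extensionality), and the
`τ^*𝒜`-isomorphism is carried to a `B`-isomorphism (★ (R1), ★ `exists_tupleRel_id_symm`, ★ `tupleRel_comp_id_id`); (Z5) the two special points `x̄ᵢ ≫ ι_s ≫
(𝒳 ◁ τ″)` land in `𝒱` (else `w ∈ under(q(∁𝒱))`), have the same `q`-value (★ A-p14 (g36) `specialPoint_stageSheet_eq`) centred at a nonzero prime `v ∉ S`
above `w` (★ `exists_heightOneSpectrum_center_specialPoint_stageSheet`), so ★ (GS-3) makes them EQUAL in the stage, and ★ (G3) + ★ `reductionAt_point_ext`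
(`reductionAt_point_eq_of_comp_whiskerLeft_eq`) recover `x̄₁ = x̄₂`.

## References
* [MumfordFogartyKirwan1994] D. Mumford, J. Fogarty, F. Kirwan, *Geometric Invariant Theory*, 3rd ed. (1994), Ch. 7 §2 Prop. 7.3 (p. 132); §3 Thm. 7.9 (pp. 139–140).
* [EGAIV3] A. Grothendieck, J. Dieudonné, *ÉGA* IV₃, Publ. Math. IHÉS 28 (1966), Thm. 8.8.2 (p. 28), Thm. 8.10.5 (p. 36), (9.2.1)–(9.2.3).
* [SerreTate1968] J.-P. Serre, J. Tate, *Good reduction of abelian varieties*, Ann. of Math. 88 (1968), §1.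
* [RapoportSmithlingZhang2020Diagonal] M. Rapoport, B. Smithling, W. Zhang, Compos. Math. 156 (2020), §4.1 Thm. 4.1 (p. 17).
-/

set_option autoImplicit false

noncomputable section

-- Mathlib's `Over`/pull-back API is stated across semireducible wrappers (as in the ★ `AbelianSchemes/*` files).
set_option backward.isDefEq.respectTransparency false

open CategoryTheory CategoryTheory.Limits AlgebraicGeometry MonoidalCategory IsDedekindDomain
open scoped NumberField
open Literature.AlgebraicGeometry.Motives (SchemeOver specOver AlgPoints IntegralModel thickening thickeningLift baseChange)
open Literature.AlgebraicGeometry.Limits.LocApprox (Idx baseDiagram leg)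
open Literature.NumberTheory.DiophantineGeometry (specResidueField geomResidueField)
open Literature.NumberTheory.EllipticCurves (specGenericPoint)

namespace Literature.AlgebraicGeometry.AbelianSchemes

namespace AbelianSchemeOver

/-- If `P` yields a witness, some witness serves `P` (classical bookkeeping for «the finite set of ★ (GS-3) if its hypothesis holds, else anything»). [folklore] -/
private theorem exists_forall_of_imp {α : Sort*} [Nonempty α] {P : Prop} {Q : α → Prop} (f : P → ∃ a, Q a) : ∃ a, P → Q a := by
  by_cases hP : P
  · exact (f hP).imp fun a ha _ => ha
  · exact ⟨Classical.arbitrary α, fun h => absurd h hP⟩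

/-- Finitely many height-one primes have their ideal in a given finite family («primes under a finite set»). [folklore] -/
private theorem finite_setOf_exists_eq_asIdeal {R : Type*} [CommRing R] {ι : Type*} {s : Set ι} (hs : s.Finite) (I : ι → Ideal R) :
    {w : HeightOneSpectrum R | ∃ i ∈ s, I i = w.asIdeal}.Finite := by
  refine (hs.biUnion (t := fun i => {w : HeightOneSpectrum R | I i = w.asIdeal}) fun i _ => ?_).subset fun w ⟨i, hi, hw⟩ => Set.mem_biUnion hi hw
  exact Set.Subsingleton.finite fun w hw w' hw' => HeightOneSpectrum.ext (hw.symm.trans hw')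

/-- Transport of the six-clause letter along equalities of the two points (used instead of `rw` inside the large letters). [folklore] -/
private theorem tupleIso_congr_points {T Y : Scheme.{0}} {O : Type} [CommRing O] (𝒜 : AbelianSchemeOver Y) (ρ : RingAction O 𝒜) (D : 𝒜.DualPair)
    (pol : 𝒜.Polarization D) {g N : ℕ} (lvl : 𝒜.LevelStructure g N) {x₁ x₁' x₂ x₂' : T ⟶ Y} (h₁ : x₁ = x₁') (h₂ : x₂ = x₂')
    (h : ∃ (G : (𝒜.baseChange x₁).X.left ⟶ (𝒜.baseChange x₂).X.left) (Ĝ : (D.baseChange x₁).hat.X.left ⟶ (D.baseChange x₂).hat.X.left),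
        (lvl.baseChange x₁).IsBaseChangeVia (lvl.baseChange x₂) (𝟙 T) G ∧ (D.baseChange x₁).hat.IsBaseChangeVia (D.baseChange x₂).hat (𝟙 T) Ĝ ∧
        (∃ (wG : (𝒜.baseChange x₁).X.hom ≫ 𝟙 T = G ≫ (𝒜.baseChange x₂).X.hom) (wĜ : (D.baseChange x₁).hat.X.hom ≫ 𝟙 T = Ĝ ≫ (D.baseChange x₂).hat.X.hom),
          Nonempty ((Scheme.Modules.pullback (pullback.map (𝒜.baseChange x₁).X.hom (D.baseChange x₁).hat.X.hom (𝒜.baseChange x₂).X.hom (D.baseChange x₂).hat.X.hom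
              G Ĝ (𝟙 T) wG wĜ)).obj (D.baseChange x₂).P ≅ (D.baseChange x₁).P)) ∧ (pol.baseChange x₁).lam.left ≫ Ĝ = G ≫ (pol.baseChange x₂).lam.left ∧
        ∀ a : O, (baseChangeHom (ρ.i a) x₁).left ≫ G = G ≫ (baseChangeHom (ρ.i a) x₂).left) :
    ∃ (G : (𝒜.baseChange x₁').X.left ⟶ (𝒜.baseChange x₂').X.left) (Ĝ : (D.baseChange x₁').hat.X.left ⟶ (D.baseChange x₂').hat.X.left),
        (lvl.baseChange x₁').IsBaseChangeVia (lvl.baseChange x₂') (𝟙 T) G ∧ (D.baseChange x₁').hat.IsBaseChangeVia (D.baseChange x₂').hat (𝟙 T) Ĝ ∧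
        (∃ (wG : (𝒜.baseChange x₁').X.hom ≫ 𝟙 T = G ≫ (𝒜.baseChange x₂').X.hom) (wĜ : (D.baseChange x₁').hat.X.hom ≫ 𝟙 T = Ĝ ≫ (D.baseChange x₂').hat.X.hom),
          Nonempty ((Scheme.Modules.pullback (pullback.map (𝒜.baseChange x₁').X.hom (D.baseChange x₁').hat.X.hom (𝒜.baseChange x₂').X.hom (D.baseChange x₂').hat.X.hom
              G Ĝ (𝟙 T) wG wĜ)).obj (D.baseChange x₂').P ≅ (D.baseChange x₁').P)) ∧ (pol.baseChange x₁').lam.left ≫ Ĝ = G ≫ (pol.baseChange x₂').lam.left ∧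
        ∀ a : O, (baseChangeHom (ρ.i a) x₁').left ≫ G = G ≫ (baseChangeHom (ρ.i a) x₂').left := by
  subst h₁ h₂
  exact h

variable {F Fi : Type} [Field F] [NumberField F] [Field Fi] [NumberField Fi] [Algebra F Fi]

/-- **HEAD — THE `stub_INJ0` CORE: special fine-moduli injectivity off a finite set of primes for a stage tuple localised at `w`, from one-sheet generic
separation of a tuple reading it.**  See the module docstring for the statement in words and the proof.  The three displayed hypotheses∕conclusion are, in
the P-line's tokens after `obtain ⟨…⟩ := T` and `subst` of `IsStageLocalisationAt`: `sepB = ESepAt S Kc w T.E e`, `readB = T.gen_iso e`, the last binder =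
the hypothesis of `PELInj0LawAt … T y₁ y₂` (`tupleIsoAt (spPt 𝓜 w (red₀Of … e y₁)) (spPt 𝓜 w (red₀Of … e y₂)) T.univ T.act T.dual T.pol T.lvl`), the conclusion
= `red₀Of … e y₁ = red₀Of … e y₂`. [cite: MumfordFogartyKirwan1994, Ch. 7 §2 Proposition 7.3 (p. 132); §3 Theorem 7.9 (pp. 139–140)]
[cite: EGAIV3, Thm. 8.8.2 (p. 28) and (9.2.1)–(9.2.3)] [cite: SerreTate1968, §1] [cite: RapoportSmithlingZhang2020Diagonal, §4.1 Thm. 4.1 p. 17] -/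
theorem exists_finite_forall_geomReductionMap_eq_of_tupleIso_stage (X : SchemeOver F) (𝒳 : IntegralModel (𝓞 F) F ((thickening F Fi).obj X))
    [QuasiCompact 𝒳.total.hom] [QuasiSeparated 𝒳.total.hom] [LocallyOfFinitePresentation 𝒳.total.hom] [IsSeparated 𝒳.total.hom] (t : Idx (nonZeroDivisors (𝓞 F)))
    (𝒜 : AbelianSchemeOver (𝒳.total ⊗ (baseDiagram (nonZeroDivisors (𝓞 F))).obj t).left)
    {O : Type} [CommRing O] (ρ : RingAction O 𝒜) (D : 𝒜.DualPair) (pol : 𝒜.Polarization D) {g N : ℕ} (lvl : 𝒜.LevelStructure g N) :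
    ∃ S_inj : Set (HeightOneSpectrum (𝓞 F)), S_inj.Finite ∧ ∀ (w : HeightOneSpectrum (𝓞 F)), w ∉ S_inj →
      ∀ (τ : specOver (𝓞 F) (HeightOneSpectrum.valuationSubringAtPrime F w) ⟶ (baseDiagram (nonZeroDivisors (𝓞 F))).obj t) [IsProper (𝒳.localise w).total.hom]
        (e : Fi →ₐ[F] AlgebraicClosure (w.adicCompletion F))
        (B : AbelianSchemeOver ((thickening F Fi).obj X).left) (ρB : RingAction O B) (DB : B.DualPair) (polB : B.Polarization DB) (lvlB : B.LevelStructure g N),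
      -- (sepB) `B` separates the `Ω̄_w`-points of `X` on the sheet `e` (`ESepAt … T.E e`)
      (∀ (y₁ y₂ : AlgPoints X (AlgebraicClosure (w.adicCompletion F))),
        (∃ (G : (B.baseChange (thickeningLift e X y₁).left).X.left ⟶ (B.baseChange (thickeningLift e X y₂).left).X.left)
            (Ĝ : (DB.baseChange (thickeningLift e X y₁).left).hat.X.left ⟶ (DB.baseChange (thickeningLift e X y₂).left).hat.X.left),
          (lvlB.baseChange (thickeningLift e X y₁).left).IsBaseChangeVia (lvlB.baseChange (thickeningLift e X y₂).left)
              (𝟙 (Spec (CommRingCat.of (AlgebraicClosure (w.adicCompletion F))))) G ∧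
          (DB.baseChange (thickeningLift e X y₁).left).hat.IsBaseChangeVia (DB.baseChange (thickeningLift e X y₂).left).hat
              (𝟙 (Spec (CommRingCat.of (AlgebraicClosure (w.adicCompletion F))))) Ĝ ∧
          (∃ (wG : (B.baseChange (thickeningLift e X y₁).left).X.hom ≫ 𝟙 (Spec (CommRingCat.of (AlgebraicClosure (w.adicCompletion F)))) =
                G ≫ (B.baseChange (thickeningLift e X y₂).left).X.hom)
              (wĜ : (DB.baseChange (thickeningLift e X y₁).left).hat.X.hom ≫ 𝟙 (Spec (CommRingCat.of (AlgebraicClosure (w.adicCompletion F)))) =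
                Ĝ ≫ (DB.baseChange (thickeningLift e X y₂).left).hat.X.hom), Nonempty ((Scheme.Modules.pullback
                (pullback.map (B.baseChange (thickeningLift e X y₁).left).X.hom (DB.baseChange (thickeningLift e X y₁).left).hat.X.hom
                  (B.baseChange (thickeningLift e X y₂).left).X.hom (DB.baseChange (thickeningLift e X y₂).left).hat.X.hom G Ĝ
                  (𝟙 (Spec (CommRingCat.of (AlgebraicClosure (w.adicCompletion F))))) wG wĜ)).obj (DB.baseChange (thickeningLift e X y₂).left).P ≅
              (DB.baseChange (thickeningLift e X y₁).left).P)) ∧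
          (polB.baseChange (thickeningLift e X y₁).left).lam.left ≫ Ĝ = G ≫ (polB.baseChange (thickeningLift e X y₂).left).lam.left ∧
          ∀ a : O, (baseChangeHom (ρB.i a) (thickeningLift e X y₁).left).left ≫ G = G ≫ (baseChangeHom (ρB.i a) (thickeningLift e X y₂).left).left) → y₁ = y₂) →
      -- (readB) `B` reads `τ^*𝒜` at the generic points `ℓ_e y` of the sheet `e` (`T.gen_iso e`)
      (∀ (y : AlgPoints X (AlgebraicClosure (w.adicCompletion F))),
        ∃ (G : (((𝒜.baseChange (show (𝒳.localise w).total.left ⟶ (𝒳.total ⊗ (baseDiagram (nonZeroDivisors (𝓞 F))).obj t).left from (𝒳.total ◁ τ).left)).baseChange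
                ((𝒳.localise w).genericIso'.inv.left ≫ pullback.fst (𝒳.localise w).total.hom
                  (specGenericPoint (HeightOneSpectrum.valuationSubringAtPrime F w) F))).baseChange (thickeningLift e X y).left).X.left ⟶
              (B.baseChange (thickeningLift e X y).left).X.left)
          (Ĝ : (((D.baseChange (show (𝒳.localise w).total.left ⟶ (𝒳.total ⊗ (baseDiagram (nonZeroDivisors (𝓞 F))).obj t).left from (𝒳.total ◁ τ).left)).baseChange
                ((𝒳.localise w).genericIso'.inv.left ≫ pullback.fst (𝒳.localise w).total.hom
                  (specGenericPoint (HeightOneSpectrum.valuationSubringAtPrime F w) F))).baseChange (thickeningLift e X y).left).hat.X.left ⟶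
              (DB.baseChange (thickeningLift e X y).left).hat.X.left),
          (((lvl.baseChange (show (𝒳.localise w).total.left ⟶ (𝒳.total ⊗ (baseDiagram (nonZeroDivisors (𝓞 F))).obj t).left from (𝒳.total ◁ τ).left)).baseChange
                ((𝒳.localise w).genericIso'.inv.left ≫ pullback.fst (𝒳.localise w).total.hom
                  (specGenericPoint (HeightOneSpectrum.valuationSubringAtPrime F w) F))).baseChange (thickeningLift e X y).left).IsBaseChangeVia
              (lvlB.baseChange (thickeningLift e X y).left) (𝟙 (Spec (CommRingCat.of (AlgebraicClosure (w.adicCompletion F))))) G ∧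
          (((D.baseChange (show (𝒳.localise w).total.left ⟶ (𝒳.total ⊗ (baseDiagram (nonZeroDivisors (𝓞 F))).obj t).left from (𝒳.total ◁ τ).left)).baseChange
                ((𝒳.localise w).genericIso'.inv.left ≫ pullback.fst (𝒳.localise w).total.hom
                  (specGenericPoint (HeightOneSpectrum.valuationSubringAtPrime F w) F))).baseChange (thickeningLift e X y).left).hat.IsBaseChangeVia
              (DB.baseChange (thickeningLift e X y).left).hat (𝟙 (Spec (CommRingCat.of (AlgebraicClosure (w.adicCompletion F))))) Ĝ ∧
          (∃ (wG : (((𝒜.baseChange (show (𝒳.localise w).total.left ⟶ (𝒳.total ⊗ (baseDiagram (nonZeroDivisors (𝓞 F))).obj t).left from (𝒳.total ◁ τ).left)).baseChange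
                    ((𝒳.localise w).genericIso'.inv.left ≫ pullback.fst (𝒳.localise w).total.hom
                      (specGenericPoint (HeightOneSpectrum.valuationSubringAtPrime F w) F))).baseChange (thickeningLift e X y).left).X.hom ≫
                  𝟙 (Spec (CommRingCat.of (AlgebraicClosure (w.adicCompletion F)))) = G ≫ (B.baseChange (thickeningLift e X y).left).X.hom)
              (wĜ : (((D.baseChange (show (𝒳.localise w).total.left ⟶ (𝒳.total ⊗ (baseDiagram (nonZeroDivisors (𝓞 F))).obj t).left from (𝒳.total ◁ τ).left)).baseChange
                    ((𝒳.localise w).genericIso'.inv.left ≫ pullback.fst (𝒳.localise w).total.hom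
                      (specGenericPoint (HeightOneSpectrum.valuationSubringAtPrime F w) F))).baseChange (thickeningLift e X y).left).hat.X.hom ≫
                  𝟙 (Spec (CommRingCat.of (AlgebraicClosure (w.adicCompletion F)))) = Ĝ ≫ (DB.baseChange (thickeningLift e X y).left).hat.X.hom),
            Nonempty ((Scheme.Modules.pullback (pullback.map (((𝒜.baseChange (show (𝒳.localise w).total.left ⟶ (𝒳.total ⊗ (baseDiagram (nonZeroDivisors (𝓞 F))).obj t).left from
                      (𝒳.total ◁ τ).left)).baseChange ((𝒳.localise w).genericIso'.inv.left ≫ pullback.fst (𝒳.localise w).total.hom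
                      (specGenericPoint (HeightOneSpectrum.valuationSubringAtPrime F w) F))).baseChange (thickeningLift e X y).left).X.hom
                  (((D.baseChange (show (𝒳.localise w).total.left ⟶ (𝒳.total ⊗ (baseDiagram (nonZeroDivisors (𝓞 F))).obj t).left from (𝒳.total ◁ τ).left)).baseChange
                    ((𝒳.localise w).genericIso'.inv.left ≫ pullback.fst (𝒳.localise w).total.hom
                      (specGenericPoint (HeightOneSpectrum.valuationSubringAtPrime F w) F))).baseChange (thickeningLift e X y).left).hat.X.hom
                  (B.baseChange (thickeningLift e X y).left).X.hom (DB.baseChange (thickeningLift e X y).left).hat.X.hom G Ĝ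
                  (𝟙 (Spec (CommRingCat.of (AlgebraicClosure (w.adicCompletion F))))) wG wĜ)).obj (DB.baseChange (thickeningLift e X y).left).P ≅
              (((D.baseChange (show (𝒳.localise w).total.left ⟶ (𝒳.total ⊗ (baseDiagram (nonZeroDivisors (𝓞 F))).obj t).left from (𝒳.total ◁ τ).left)).baseChange
                  ((𝒳.localise w).genericIso'.inv.left ≫ pullback.fst (𝒳.localise w).total.hom
                    (specGenericPoint (HeightOneSpectrum.valuationSubringAtPrime F w) F))).baseChange (thickeningLift e X y).left).P)) ∧
          (((pol.baseChange (show (𝒳.localise w).total.left ⟶ (𝒳.total ⊗ (baseDiagram (nonZeroDivisors (𝓞 F))).obj t).left from (𝒳.total ◁ τ).left)).baseChange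
                ((𝒳.localise w).genericIso'.inv.left ≫ pullback.fst (𝒳.localise w).total.hom
                  (specGenericPoint (HeightOneSpectrum.valuationSubringAtPrime F w) F))).baseChange (thickeningLift e X y).left).lam.left ≫ Ĝ =
            G ≫ (polB.baseChange (thickeningLift e X y).left).lam.left ∧
          ∀ a : O, (baseChangeHom (((ρ.baseChange (show (𝒳.localise w).total.left ⟶ (𝒳.total ⊗ (baseDiagram (nonZeroDivisors (𝓞 F))).obj t).left from
                  (𝒳.total ◁ τ).left)).baseChange ((𝒳.localise w).genericIso'.inv.left ≫ pullback.fst (𝒳.localise w).total.hom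
                  (specGenericPoint (HeightOneSpectrum.valuationSubringAtPrime F w) F))).i a) (thickeningLift e X y).left).left ≫ G =
            G ≫ (baseChangeHom (ρB.i a) (thickeningLift e X y).left).left) →
      -- the law: special `τ^*𝒜`-tuples isomorphic ⇒ special points equal
      ∀ (y₁ y₂ : AlgPoints X (AlgebraicClosure (w.adicCompletion F))),
        (∃ (G : ((𝒜.baseChange (show (𝒳.localise w).total.left ⟶ (𝒳.total ⊗ (baseDiagram (nonZeroDivisors (𝓞 F))).obj t).left from (𝒳.total ◁ τ).left)).baseChange
                (((𝒳.localise w).geomReductionMap (thickeningLift e X y₁)).left ≫ pullback.fst (𝒳.localise w).total.hom (specResidueField w))).X.left ⟶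
              ((𝒜.baseChange (show (𝒳.localise w).total.left ⟶ (𝒳.total ⊗ (baseDiagram (nonZeroDivisors (𝓞 F))).obj t).left from (𝒳.total ◁ τ).left)).baseChange
                (((𝒳.localise w).geomReductionMap (thickeningLift e X y₂)).left ≫ pullback.fst (𝒳.localise w).total.hom (specResidueField w))).X.left)
            (Ĝ : ((D.baseChange (show (𝒳.localise w).total.left ⟶ (𝒳.total ⊗ (baseDiagram (nonZeroDivisors (𝓞 F))).obj t).left from (𝒳.total ◁ τ).left)).baseChange
                (((𝒳.localise w).geomReductionMap (thickeningLift e X y₁)).left ≫ pullback.fst (𝒳.localise w).total.hom (specResidueField w))).hat.X.left ⟶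
              ((D.baseChange (show (𝒳.localise w).total.left ⟶ (𝒳.total ⊗ (baseDiagram (nonZeroDivisors (𝓞 F))).obj t).left from (𝒳.total ◁ τ).left)).baseChange
                (((𝒳.localise w).geomReductionMap (thickeningLift e X y₂)).left ≫ pullback.fst (𝒳.localise w).total.hom (specResidueField w))).hat.X.left),
          ((lvl.baseChange (show (𝒳.localise w).total.left ⟶ (𝒳.total ⊗ (baseDiagram (nonZeroDivisors (𝓞 F))).obj t).left from (𝒳.total ◁ τ).left)).baseChange
              (((𝒳.localise w).geomReductionMap (thickeningLift e X y₁)).left ≫ pullback.fst (𝒳.localise w).total.hom (specResidueField w))).IsBaseChangeVia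
            ((lvl.baseChange (show (𝒳.localise w).total.left ⟶ (𝒳.total ⊗ (baseDiagram (nonZeroDivisors (𝓞 F))).obj t).left from (𝒳.total ◁ τ).left)).baseChange
              (((𝒳.localise w).geomReductionMap (thickeningLift e X y₂)).left ≫ pullback.fst (𝒳.localise w).total.hom (specResidueField w)))
            (𝟙 (Spec (CommRingCat.of (geomResidueField w)))) G ∧
          ((D.baseChange (show (𝒳.localise w).total.left ⟶ (𝒳.total ⊗ (baseDiagram (nonZeroDivisors (𝓞 F))).obj t).left from (𝒳.total ◁ τ).left)).baseChange
              (((𝒳.localise w).geomReductionMap (thickeningLift e X y₁)).left ≫ pullback.fst (𝒳.localise w).total.hom (specResidueField w))).hat.IsBaseChangeVia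
            ((D.baseChange (show (𝒳.localise w).total.left ⟶ (𝒳.total ⊗ (baseDiagram (nonZeroDivisors (𝓞 F))).obj t).left from (𝒳.total ◁ τ).left)).baseChange
              (((𝒳.localise w).geomReductionMap (thickeningLift e X y₂)).left ≫ pullback.fst (𝒳.localise w).total.hom (specResidueField w))).hat
            (𝟙 (Spec (CommRingCat.of (geomResidueField w)))) Ĝ ∧
          (∃ (wG : ((𝒜.baseChange (show (𝒳.localise w).total.left ⟶ (𝒳.total ⊗ (baseDiagram (nonZeroDivisors (𝓞 F))).obj t).left from (𝒳.total ◁ τ).left)).baseChange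
                    (((𝒳.localise w).geomReductionMap (thickeningLift e X y₁)).left ≫ pullback.fst (𝒳.localise w).total.hom (specResidueField w))).X.hom ≫
                  𝟙 (Spec (CommRingCat.of (geomResidueField w))) =
                G ≫ ((𝒜.baseChange (show (𝒳.localise w).total.left ⟶ (𝒳.total ⊗ (baseDiagram (nonZeroDivisors (𝓞 F))).obj t).left from (𝒳.total ◁ τ).left)).baseChange
                    (((𝒳.localise w).geomReductionMap (thickeningLift e X y₂)).left ≫ pullback.fst (𝒳.localise w).total.hom (specResidueField w))).X.hom)
              (wĜ : ((D.baseChange (show (𝒳.localise w).total.left ⟶ (𝒳.total ⊗ (baseDiagram (nonZeroDivisors (𝓞 F))).obj t).left from (𝒳.total ◁ τ).left)).baseChange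
                    (((𝒳.localise w).geomReductionMap (thickeningLift e X y₁)).left ≫ pullback.fst (𝒳.localise w).total.hom (specResidueField w))).hat.X.hom ≫
                  𝟙 (Spec (CommRingCat.of (geomResidueField w))) =
                Ĝ ≫ ((D.baseChange (show (𝒳.localise w).total.left ⟶ (𝒳.total ⊗ (baseDiagram (nonZeroDivisors (𝓞 F))).obj t).left from (𝒳.total ◁ τ).left)).baseChange
                    (((𝒳.localise w).geomReductionMap (thickeningLift e X y₂)).left ≫ pullback.fst (𝒳.localise w).total.hom (specResidueField w))).hat.X.hom),
            Nonempty ((Scheme.Modules.pullback (pullback.map ((𝒜.baseChange (show (𝒳.localise w).total.left ⟶ (𝒳.total ⊗ (baseDiagram (nonZeroDivisors (𝓞 F))).obj t).left from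
                      (𝒳.total ◁ τ).left)).baseChange
                    (((𝒳.localise w).geomReductionMap (thickeningLift e X y₁)).left ≫ pullback.fst (𝒳.localise w).total.hom (specResidueField w))).X.hom
                  ((D.baseChange (show (𝒳.localise w).total.left ⟶ (𝒳.total ⊗ (baseDiagram (nonZeroDivisors (𝓞 F))).obj t).left from (𝒳.total ◁ τ).left)).baseChange
                    (((𝒳.localise w).geomReductionMap (thickeningLift e X y₁)).left ≫ pullback.fst (𝒳.localise w).total.hom (specResidueField w))).hat.X.hom
                  ((𝒜.baseChange (show (𝒳.localise w).total.left ⟶ (𝒳.total ⊗ (baseDiagram (nonZeroDivisors (𝓞 F))).obj t).left from (𝒳.total ◁ τ).left)).baseChange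
                    (((𝒳.localise w).geomReductionMap (thickeningLift e X y₂)).left ≫ pullback.fst (𝒳.localise w).total.hom (specResidueField w))).X.hom
                  ((D.baseChange (show (𝒳.localise w).total.left ⟶ (𝒳.total ⊗ (baseDiagram (nonZeroDivisors (𝓞 F))).obj t).left from (𝒳.total ◁ τ).left)).baseChange
                    (((𝒳.localise w).geomReductionMap (thickeningLift e X y₂)).left ≫ pullback.fst (𝒳.localise w).total.hom (specResidueField w))).hat.X.hom
                  G Ĝ (𝟙 (Spec (CommRingCat.of (geomResidueField w)))) wG wĜ)).obj
                ((D.baseChange (show (𝒳.localise w).total.left ⟶ (𝒳.total ⊗ (baseDiagram (nonZeroDivisors (𝓞 F))).obj t).left from (𝒳.total ◁ τ).left)).baseChange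
                  (((𝒳.localise w).geomReductionMap (thickeningLift e X y₂)).left ≫ pullback.fst (𝒳.localise w).total.hom (specResidueField w))).P ≅
              ((D.baseChange (show (𝒳.localise w).total.left ⟶ (𝒳.total ⊗ (baseDiagram (nonZeroDivisors (𝓞 F))).obj t).left from (𝒳.total ◁ τ).left)).baseChange
                  (((𝒳.localise w).geomReductionMap (thickeningLift e X y₁)).left ≫ pullback.fst (𝒳.localise w).total.hom (specResidueField w))).P)) ∧
          ((pol.baseChange (show (𝒳.localise w).total.left ⟶ (𝒳.total ⊗ (baseDiagram (nonZeroDivisors (𝓞 F))).obj t).left from (𝒳.total ◁ τ).left)).baseChange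
              (((𝒳.localise w).geomReductionMap (thickeningLift e X y₁)).left ≫ pullback.fst (𝒳.localise w).total.hom (specResidueField w))).lam.left ≫ Ĝ =
            G ≫ ((pol.baseChange (show (𝒳.localise w).total.left ⟶ (𝒳.total ⊗ (baseDiagram (nonZeroDivisors (𝓞 F))).obj t).left from (𝒳.total ◁ τ).left)).baseChange
              (((𝒳.localise w).geomReductionMap (thickeningLift e X y₂)).left ≫ pullback.fst (𝒳.localise w).total.hom (specResidueField w))).lam.left ∧
          ∀ a : O, (baseChangeHom ((ρ.baseChange (show (𝒳.localise w).total.left ⟶ (𝒳.total ⊗ (baseDiagram (nonZeroDivisors (𝓞 F))).obj t).left from (𝒳.total ◁ τ).left)).i a)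
                (((𝒳.localise w).geomReductionMap (thickeningLift e X y₁)).left ≫ pullback.fst (𝒳.localise w).total.hom (specResidueField w))).left ≫ G =
            G ≫ (baseChangeHom ((ρ.baseChange (show (𝒳.localise w).total.left ⟶ (𝒳.total ⊗ (baseDiagram (nonZeroDivisors (𝓞 F))).obj t).left from (𝒳.total ◁ τ).left)).i a)
                (((𝒳.localise w).geomReductionMap (thickeningLift e X y₂)).left ≫ pullback.fst (𝒳.localise w).total.hom (specResidueField w))).left) →
        (𝒳.localise w).geomReductionMap (thickeningLift e X y₁) = (𝒳.localise w).geomReductionMap (thickeningLift e X y₂) := by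
  classical
  -- (Z1)(Z2) a finer stage `t″ → t` with an `𝓞 Fᵢ`-sheet structure `h` and its generic value
  obtain ⟨t'', ρ₁, h, -, hgen⟩ := IntegralModel.exists_sheetStructure_of_le X 𝒳 t
  set Tr : (𝒳.total ⊗ (baseDiagram (nonZeroDivisors (𝓞 F))).obj t'').left ⟶ (𝒳.total ⊗ (baseDiagram (nonZeroDivisors (𝓞 F))).obj t).left :=
    (𝒳.total ◁ (baseDiagram (nonZeroDivisors (𝓞 F))).map ρ₁).left with hTr
  set q : (𝒳.total ⊗ (baseDiagram (nonZeroDivisors (𝓞 F))).obj t'').left ⟶ Spec (.of (𝓞 Fi)) :=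
    h.left ≫ pullback.fst (specOver (𝓞 F) (𝓞 Fi)).hom ((baseDiagram (nonZeroDivisors (𝓞 F))).obj t'').hom with hq
  haveI : QuasiCompact q := IntegralModel.quasiCompact_sheet_fst 𝒳.total t'' h
  haveI : LocallyOfFiniteType q := IntegralModel.locallyOfFiniteType_sheet_fst 𝒳.total t'' h
  haveI : IsSeparated q := IntegralModel.isSeparated_sheet_fst 𝒳.total t'' h
  haveI hN : IsNoetherian (𝒳.total ⊗ (baseDiagram (nonZeroDivisors (𝓞 F))).obj t'').left :=
    IntegralModel.isNoetherian_tensor_stage_left 𝒳.total t''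
  -- (Z3) the `Isom`-pieces of the moved tuple on an open `𝒱 ⊇` generic fibre with `q(∁𝒱)` finite
  obtain ⟨𝒱, hfinU, -, hpieces⟩ :=
    exists_opens_isomPieces q (𝒜.baseChange Tr) (ρ.baseChange Tr) (D.baseChange Tr) (pol.baseChange Tr) (lvl.baseChange Tr)
  haveI hqcι : QuasiCompact 𝒱.ι :=
    @AlgebraicGeometry.instQuasiCompactOfIsLocallyNoetherianOfIsOpenImmersion _ _ hN.toIsLocallyNoetherian 𝒱.ι inferInstance
  haveI : QuasiCompact (𝒱.ι ≫ q) := quasiCompact_comp 𝒱.ι q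
  haveI : LocallyOfFiniteType (𝒱.ι ≫ q) := locallyOfFiniteType_comp 𝒱.ι q
  haveI : IsSeparated (𝒱.ι ≫ q) := IsSeparated.stableUnderComposition.comp_mem 𝒱.ι q inferInstance inferInstance
  -- ★ (GS-3) for the moved tuple on `𝒱` over `Spec 𝓞 Fᵢ`, IF its generic-injectivity hypothesis holds
  obtain ⟨S, hS⟩ := exists_forall_of_imp fun hg =>
    exists_finset_forall_eq_of_tupleIsoAt (𝒱.ι ≫ q) ((𝒜.baseChange Tr).baseChange 𝒱.ι) ((ρ.baseChange Tr).baseChange 𝒱.ι)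
      ((D.baseChange Tr).baseChange 𝒱.ι) ((pol.baseChange Tr).baseChange 𝒱.ι) ((lvl.baseChange Tr).baseChange 𝒱.ι) hpieces hg
  -- (Z3′) the exceptional set: `w ∣ t″`, the primes under `q(∁𝒱)`, the primes under `S`
  refine ⟨{w | IsEmpty (specOver (𝓞 F) (HeightOneSpectrum.valuationSubringAtPrime F w) ⟶ (baseDiagram (nonZeroDivisors (𝓞 F))).obj t'')} ∪
      {w | ∃ p ∈ q '' ((𝒱 : Set ↥(𝒳.total ⊗ (baseDiagram (nonZeroDivisors (𝓞 F))).obj t'').left)ᶜ),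
        p.asIdeal.comap (algebraMap (𝓞 F) (𝓞 Fi)) = w.asIdeal} ∪
      {w | ∃ v ∈ (S : Set (HeightOneSpectrum (𝓞 Fi))), v.asIdeal.comap (algebraMap (𝓞 F) (𝓞 Fi)) = w.asIdeal},
    ((IntegralModel.finite_setOf_isEmpty_hom_stage t'').union
      (finite_setOf_exists_eq_asIdeal hfinU fun p => p.asIdeal.comap (algebraMap (𝓞 F) (𝓞 Fi)))).union
      (finite_setOf_exists_eq_asIdeal S.finite_toSet fun v => v.asIdeal.comap (algebraMap (𝓞 F) (𝓞 Fi))), ?_⟩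
  intro w hw τ _ e B ρB DB polB lvlB sepB readB y₁ y₂ hiso
  simp only [Set.mem_union, Set.mem_setOf_eq, not_or, not_exists, not_and, not_isEmpty_iff] at hw
  obtain ⟨⟨⟨τ''⟩, hwU⟩, hwS⟩ := hw
  -- the localisation leg through `t″`: `τ = τ″ ≫ (t″ → t)`, `stageLocLeg τ = stageLocLeg τ″ ≫ Tr`
  haveI : Mono ((baseDiagram (nonZeroDivisors (𝓞 F))).obj t).hom :=
    Limits.LocApprox.mono_specOver_hom_of_isLocalization (Submonoid.powers t.val) (Localization.Away t.val)
  have hτ : τ'' ≫ (baseDiagram (nonZeroDivisors (𝓞 F))).map ρ₁ = τ := Limits.LocApprox.hom_eq_of_mono_hom _ _ _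
  have hL : (𝒳.total ◁ τ).left = (𝒳.total ◁ τ'').left ≫ Tr := by
    rw [← hτ, MonoidalCategory.whiskerLeft_comp, Over.comp_left]
  -- (Z5) rebase the special isomorphism to the moved tuple at the points `xᵢ ≫ stageLocLeg τ″` (`xᵢ = x̄ᵢ ≫ ι_s`)
  have i1 := (exists_tupleIso_baseChange_iff_comp 𝒜 ρ D pol lvl
    (show (𝒳.localise w).total.left ⟶ (𝒳.total ⊗ (baseDiagram (nonZeroDivisors (𝓞 F))).obj t).left from (𝒳.total ◁ τ).left) _ _).mp hiso
  obtain ⟨x₁, hx₁⟩ : ∃ x₁ : Spec (.of (geomResidueField w)) ⟶ (𝒳.localise w).total.left,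
      ((𝒳.localise w).geomReductionMap (thickeningLift e X y₁)).left ≫ pullback.fst (𝒳.localise w).total.hom (specResidueField w) = x₁ :=
    ⟨_, rfl⟩
  obtain ⟨x₂, hx₂⟩ : ∃ x₂ : Spec (.of (geomResidueField w)) ⟶ (𝒳.localise w).total.left,
      ((𝒳.localise w).geomReductionMap (thickeningLift e X y₂)).left ≫ pullback.fst (𝒳.localise w).total.hom (specResidueField w) = x₂ :=
    ⟨_, rfl⟩
  have ex₁ : (((𝒳.localise w).geomReductionMap (thickeningLift e X y₁)).left ≫ pullback.fst (𝒳.localise w).total.hom (specResidueField w)) ≫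
      (show (𝒳.localise w).total.left ⟶ (𝒳.total ⊗ (baseDiagram (nonZeroDivisors (𝓞 F))).obj t).left from (𝒳.total ◁ τ).left) =
      (x₁ ≫ (𝒳.total ◁ τ'').left) ≫ Tr := by rw [hx₁, hL, Category.assoc]
  have ex₂ : (((𝒳.localise w).geomReductionMap (thickeningLift e X y₂)).left ≫ pullback.fst (𝒳.localise w).total.hom (specResidueField w)) ≫
      (show (𝒳.localise w).total.left ⟶ (𝒳.total ⊗ (baseDiagram (nonZeroDivisors (𝓞 F))).obj t).left from (𝒳.total ◁ τ).left) =
      (x₂ ≫ (𝒳.total ◁ τ'').left) ≫ Tr := by rw [hx₂, hL, Category.assoc]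
  have i2 := (exists_tupleIso_baseChange_iff_comp 𝒜 ρ D pol lvl Tr (x₁ ≫ (𝒳.total ◁ τ'').left) (x₂ ≫ (𝒳.total ◁ τ'').left)).mpr
    (tupleIso_congr_points 𝒜 ρ D pol lvl ex₁ ex₂ i1)
  -- the centres: nonzero primes `vᵢ` of `𝓞 Fᵢ` above `w`
  obtain ⟨v₁, hv₁, hvw₁⟩ := IntegralModel.exists_heightOneSpectrum_center_specialPoint_stageSheet X 𝒳 w t'' h τ''
    ((𝒳.localise w).geomReductionMap (thickeningLift e X y₁))
  obtain ⟨v₂, hv₂, hvw₂⟩ := IntegralModel.exists_heightOneSpectrum_center_specialPoint_stageSheet X 𝒳 w t'' h τ''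
    ((𝒳.localise w).geomReductionMap (thickeningLift e X y₂))
  rw [reassoc_of% hx₁] at hv₁
  rw [reassoc_of% hx₂] at hv₂
  have hv₁' : q.base ((x₁ ≫ (𝒳.total ◁ τ'').left).base (IsLocalRing.closedPoint _)) = ⟨v₁.asIdeal, v₁.isPrime⟩ := by
    have e₁ : (x₁ ≫ (𝒳.total ◁ τ'').left ≫ q).base (IsLocalRing.closedPoint _) =
        q.base ((x₁ ≫ (𝒳.total ◁ τ'').left).base (IsLocalRing.closedPoint _)) := rfl
    rw [← e₁]
    exact hv₁
  have hv₂' : q.base ((x₂ ≫ (𝒳.total ◁ τ'').left).base (IsLocalRing.closedPoint _)) = ⟨v₂.asIdeal, v₂.isPrime⟩ := by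
    have e₂ : (x₂ ≫ (𝒳.total ◁ τ'').left ≫ q).base (IsLocalRing.closedPoint _) =
        q.base ((x₂ ≫ (𝒳.total ◁ τ'').left).base (IsLocalRing.closedPoint _)) := rfl
    rw [← e₂]
    exact hv₂
  -- both special points land in `𝒱` (else `w` lies under `q(∁𝒱)`)
  have hp₁ : (x₁ ≫ (𝒳.total ◁ τ'').left).base (IsLocalRing.closedPoint _) ∈
      (𝒱 : Set ↥(𝒳.total ⊗ (baseDiagram (nonZeroDivisors (𝓞 F))).obj t'').left) := by
    by_contra hp
    exact hwU _ ⟨_, hp, rfl⟩ (by change (q.base _).asIdeal.comap _ = _; rw [hv₁']; exact hvw₁)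
  have hp₂ : (x₂ ≫ (𝒳.total ◁ τ'').left).base (IsLocalRing.closedPoint _) ∈
      (𝒱 : Set ↥(𝒳.total ⊗ (baseDiagram (nonZeroDivisors (𝓞 F))).obj t'').left) := by
    by_contra hp
    exact hwU _ ⟨_, hp, rfl⟩ (by change (q.base _).asIdeal.comap _ = _; rw [hv₂']; exact hvw₂)
  haveI : Subsingleton ↥(Spec (CommRingCat.of (geomResidueField w))) :=
    inferInstanceAs (Subsingleton (PrimeSpectrum (geomResidueField w)))
  obtain ⟨z₁, hz₁⟩ : ∃ z₁ : Spec (.of (geomResidueField w)) ⟶ (𝒱 : Scheme), z₁ ≫ 𝒱.ι = x₁ ≫ (𝒳.total ◁ τ'').left :=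
    ⟨IsOpenImmersion.lift 𝒱.ι _ (by
        rw [Scheme.Opens.range_ι]
        rintro _ ⟨p, rfl⟩
        obtain rfl := Subsingleton.elim p (IsLocalRing.closedPoint _)
        exact hp₁), IsOpenImmersion.lift_fac _ _ _⟩
  obtain ⟨z₂, hz₂⟩ : ∃ z₂ : Spec (.of (geomResidueField w)) ⟶ (𝒱 : Scheme), z₂ ≫ 𝒱.ι = x₂ ≫ (𝒳.total ◁ τ'').left :=
    ⟨IsOpenImmersion.lift 𝒱.ι _ (by
        rw [Scheme.Opens.range_ι]
        rintro _ ⟨p, rfl⟩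
        obtain rfl := Subsingleton.elim p (IsLocalRing.closedPoint _)
        exact hp₂), IsOpenImmersion.lift_fac _ _ _⟩
  have i3 := (exists_tupleIso_baseChange_iff_comp (𝒜.baseChange Tr) (ρ.baseChange Tr) (D.baseChange Tr) (pol.baseChange Tr)
    (lvl.baseChange Tr) 𝒱.ι z₁ z₂).mpr
    (tupleIso_congr_points (𝒜.baseChange Tr) (ρ.baseChange Tr) (D.baseChange Tr) (pol.baseChange Tr) (lvl.baseChange Tr) hz₁.symm hz₂.symm i2)
  -- same `q`-value (★ A-p14 (g36) (G4)) and the centre `v₁ ∉ S`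
  have hzq : z₁ ≫ 𝒱.ι ≫ q = z₂ ≫ 𝒱.ι ≫ q := by
    have h12 := IntegralModel.specialPoint_stageSheet_eq X 𝒳 w t'' h τ'' hgen e y₁ y₂
    rw [reassoc_of% hx₁, reassoc_of% hx₂] at h12
    rw [reassoc_of% hz₁, reassoc_of% hz₂]
    simpa only [hq, Category.assoc] using h12
  have hc : (z₁ ≫ 𝒱.ι ≫ q).base (IsLocalRing.closedPoint _) = ⟨v₁.asIdeal, v₁.isPrime⟩ := by
    rw [reassoc_of% hz₁]
    exact hv₁
  -- (Z4) generic injectivity of the moved tuple on `𝒱` over `Spec 𝓞 Fᵢ` — at `Ω̄_w` along `e|𝓞Fᵢ` by (sepB)+(readB), then every `Ω` by ★ (GS-3c′)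
  have hι₀ : (Spec.map (CommRingCat.ofHom ((e : Fi →+* AlgebraicClosure (w.adicCompletion F)).comp (algebraMap (𝓞 Fi) Fi)))).base
      (IsLocalRing.closedPoint _) = (⊥ : PrimeSpectrum (𝓞 Fi)) := by
    apply PrimeSpectrum.ext
    change Ideal.comap _ (IsLocalRing.closedPoint (AlgebraicClosure (w.adicCompletion F))).asIdeal = ⊥
    rw [show (IsLocalRing.closedPoint (AlgebraicClosure (w.adicCompletion F))).asIdeal = ⊥ from Ideal.eq_bot_of_prime _,
      ← RingHom.ker_eq_comap_bot]
    exact (RingHom.injective_iff_ker_eq_bot _).mp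
      ((e : Fi →+* AlgebraicClosure (w.adicCompletion F)).injective.comp (FaithfulSMul.algebraMap_injective (𝓞 Fi) Fi))
  have hgenTr : (𝒳.genericIso.inv.left ≫ (𝒳.total ◁ leg (nonZeroDivisors (𝓞 F)) F t'').left) ≫ Tr =
      ((𝒳.localise w).genericIso'.inv.left ≫ pullback.fst (𝒳.localise w).total.hom
          (specGenericPoint (HeightOneSpectrum.valuationSubringAtPrime F w) F)) ≫
        (show (𝒳.localise w).total.left ⟶ (𝒳.total ⊗ (baseDiagram (nonZeroDivisors (𝓞 F))).obj t).left from (𝒳.total ◁ τ).left) := by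
    rw [IntegralModel.genericIso'_inv_left_comp_fst_comp_whiskerLeft_left 𝒳 w t τ, Category.assoc, hTr, ← Over.comp_left,
      ← MonoidalCategory.whiskerLeft_comp, Limits.LocApprox.leg_comp_map]
  have hg := forall_eq_of_tupleIsoAt_generic_of_algClosed (𝒱.ι ≫ q) ((𝒜.baseChange Tr).baseChange 𝒱.ι) ((ρ.baseChange Tr).baseChange 𝒱.ι)
      ((D.baseChange Tr).baseChange 𝒱.ι) ((pol.baseChange Tr).baseChange 𝒱.ι) ((lvl.baseChange Tr).baseChange 𝒱.ι) hpieces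
      (AlgebraicClosure (w.adicCompletion F))
      (CommRingCat.ofHom ((e : Fi →+* AlgebraicClosure (w.adicCompletion F)).comp (algebraMap (𝓞 Fi) Fi))) hι₀ (by
    intro u₁ u₂ hu₁ hu₂ hiso'
    -- both points are generic points on the sheet `e`
    obtain ⟨y₁', hy₁⟩ := IntegralModel.exists_thickeningLift_eq_of_comp_sheet_fst_eq X 𝒳 t'' h hgen e (u₁ ≫ 𝒱.ι)
      (by simpa only [Category.assoc, hq] using hu₁)
    obtain ⟨y₂', hy₂⟩ := IntegralModel.exists_thickeningLift_eq_of_comp_sheet_fst_eq X 𝒳 t'' h hgen e (u₂ ≫ 𝒱.ι)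
      (by simpa only [Category.assoc, hq] using hu₂)
    -- rebase: moved tuple on `𝒱` at `(u₁, u₂)` → `𝒜` at `(ℓ_e yᵢ′ ≫ genIncl ≫ stageLocLeg τ)`
    have j1 := tupleIso_congr_points (𝒜.baseChange Tr) (ρ.baseChange Tr) (D.baseChange Tr) (pol.baseChange Tr) (lvl.baseChange Tr) hy₁ hy₂
      ((exists_tupleIso_baseChange_iff_comp (𝒜.baseChange Tr) (ρ.baseChange Tr) (D.baseChange Tr) (pol.baseChange Tr)
        (lvl.baseChange Tr) 𝒱.ι u₁ u₂).mp hiso')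
    have j2 := (exists_tupleIso_baseChange_iff_comp 𝒜 ρ D pol lvl Tr _ _).mp j1
    have hpt : ∀ y : AlgPoints X (AlgebraicClosure (w.adicCompletion F)),
        ((thickeningLift e X y).left ≫ 𝒳.genericIso.inv.left ≫ (𝒳.total ◁ leg (nonZeroDivisors (𝓞 F)) F t'').left) ≫ Tr =
          (thickeningLift e X y).left ≫
            ((𝒳.localise w).genericIso'.inv.left ≫ pullback.fst (𝒳.localise w).total.hom
              (specGenericPoint (HeightOneSpectrum.valuationSubringAtPrime F w) F)) ≫
            (show (𝒳.localise w).total.left ⟶ (𝒳.total ⊗ (baseDiagram (nonZeroDivisors (𝓞 F))).obj t).left from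
              (𝒳.total ◁ τ).left) := fun y => by
      rw [← hgenTr, Category.assoc]
    -- the geometric point is reduced, locally Noetherian, connected
    haveI : PreconnectedSpace ↥(Spec (CommRingCat.of (AlgebraicClosure (w.adicCompletion F)))) :=
      ⟨(PreirreducibleSpace.isPreirreducible_univ (X := ↥(Spec (CommRingCat.of (AlgebraicClosure (w.adicCompletion F)))))).isPreconnected⟩
    haveI : IsReduced (specOver F (AlgebraicClosure (w.adicCompletion F))).left :=
      inferInstanceAs (IsReduced (Spec (CommRingCat.of (AlgebraicClosure (w.adicCompletion F)))))
    haveI : IsLocallyNoetherian (specOver F (AlgebraicClosure (w.adicCompletion F))).left :=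
      inferInstanceAs (IsLocallyNoetherian (Spec (CommRingCat.of (AlgebraicClosure (w.adicCompletion F)))))
    haveI : PreconnectedSpace ↥(specOver F (AlgebraicClosure (w.adicCompletion F))).left :=
      inferInstanceAs (PreconnectedSpace ↥(Spec (CommRingCat.of (AlgebraicClosure (w.adicCompletion F)))))
    have hy : y₁' = y₂' :=
      forall_eq_of_tupleIso_comp_comp_of_reads_of_separates
        ((𝒳.localise w).genericIso'.inv.left ≫ pullback.fst (𝒳.localise w).total.hom
          (specGenericPoint (HeightOneSpectrum.valuationSubringAtPrime F w) F))
        (show (𝒳.localise w).total.left ⟶ (𝒳.total ⊗ (baseDiagram (nonZeroDivisors (𝓞 F))).obj t).left from (𝒳.total ◁ τ).left)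
        𝒜 ρ D pol lvl B ρB DB polB lvlB (fun y => (thickeningLift e X y).left) sepB readB y₁' y₂'
        (tupleIso_congr_points 𝒜 ρ D pol lvl (hpt y₁') (hpt y₂') j2)
    subst hy
    rw [← cancel_mono 𝒱.ι, hy₁, hy₂])
  -- (Z5, end) ★ (GS-3) at `v₁ ∉ S`: the two special points are EQUAL in the stage, hence equal
  have hz : z₁ = z₂ := hS hg v₁ (fun hv => hwS v₁ hv hvw₁) z₁ z₂ hzq hc i3
  have hx : x₁ ≫ (𝒳.total ◁ τ'').left = x₂ ≫ (𝒳.total ◁ τ'').left := by rw [← hz₁, ← hz₂, hz]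
  rw [← hx₁, ← hx₂, Category.assoc, Category.assoc] at hx
  exact IntegralModel.reductionAt_point_eq_of_comp_whiskerLeft_eq w t'' τ'' 𝒳 _ _ hx

end AbelianSchemeOver

end Literature.AlgebraicGeometry.AbelianSchemes

end
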